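import Summits.NavierStokesRegularity.NavierStokesRegularity.Theorems.AdiabaticEddyChiralEddyExistsModulation

/-!
# Vorticity of the modulated field (support of `ChiralEddyExists`)

Helper file for item `stmt-NavierStokesRegularity-10397` (`ChiralEddyExists`, route AdiabaticEddy;
lands `--supports`).  Continuing `AdiabaticEddyChiralEddyExistsModulation` (Gavrilov's localisation
`Ũ = 𝟙_N φ(P) U` with a general cutoff), we compute on the good set `W`

* `curl Ũ = φ(P) ω + φ'(P) N`, `ω = curl U`, `N = ∇P × U` (`curl_modulate_of_mem`),
* `curl curl Ũ = φ(P) curl ω + φ'(P) (∇P × ω + curl N) + φ''(P) ∇P × N` (`curl_curl_modulate_of_mem`),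
* the pointwise superhelicity density `⟪curl Ũ, curl curl Ũ⟫` as a quadratic expression in
  `φ, φ', φ''` (`inner_curl_curl_curl_modulate`), its polarised form against the unmodulated field
  (`inner_curl_plateau`) and the helicity density `⟪Ũ, curl Ũ⟫ = φ(P)² ⟪U, curl U⟫`
  (`inner_modulate_curl_modulate`),

and in the zero zones all these vanish (`curl_modulate_eq_zero`).
-/

noncomputable section

set_option linter.dupNamespace false -- nested layout Summit.<S>.<Sub>, Sub = S (D-0017)

open Set Filter Function WithLp InnerProductSpace MeasureTheory
open scoped Topology RealInnerProductSpace

namespace Summit.NavierStokesRegularity.NavierStokesRegularity.Theorems.ChiralEddyExists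

open Literature.Analysis.FluidPDE Literature.Analysis.FluidPDE.Gavrilov

/-! ### The vorticity of the modulated field -/

section Curl

variable {U : EuclideanSpace ℝ (Fin 3) → EuclideanSpace ℝ (Fin 3)} {P : EuclideanSpace ℝ (Fin 3) → ℝ}
  {W Nn : Set (EuclideanSpace ℝ (Fin 3))} {ε : ℝ} {φ : ℝ → ℝ} {x : EuclideanSpace ℝ (Fin 3)}

/-- **Leibniz rule** `curl (φ(P) U) = φ(P) curl U + φ'(P) ∇P × U` at a point of
differentiability. -/
theorem curl_smul_comp (hUx : DifferentiableAt ℝ U x) (hPx : DifferentiableAt ℝ P x)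
    (hφx : DifferentiableAt ℝ φ (P x)) :
    curl (fun y => φ (P y) • U y) x =
      φ (P x) • curl U x + deriv φ (P x) • cross (gradient P x) (U x) := by
  have hc := hasFDerivAt_comp_scalar hPx hφx.hasDerivAt
  rw [curl_smul hc.differentiableAt hUx, hc.fderiv]
  congr 1
  ext i
  fin_cases i <;>
    simp [curlCLM, curlLM, cross, cross_apply, AnsatzData.gradient_apply, mul_comm, mul_left_comm,
      mul_sub]

/-- `curl` of a field that is `C^∞` on an open set is `C^∞` there. -/
theorem contDiffOn_curl_of_isOpen (hW : IsOpen W) (hU : ContDiffOn ℝ (⊤ : ℕ∞) U W) :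
    ContDiffOn ℝ (⊤ : ℕ∞) (curl U) W := by
  rw [curl_eq_curlCLM_comp]
  exact curlCLM.contDiff.comp_contDiffOn (hU.fderiv_of_isOpen hW (by simp))

/-- `N = ∇P × U` is `C^∞` on an open set where `P` and `U` are. -/
theorem contDiffOn_cross_gradient (hW : IsOpen W) (hU : ContDiffOn ℝ (⊤ : ℕ∞) U W)
    (hP : ContDiffOn ℝ (⊤ : ℕ∞) P W) :
    ContDiffOn ℝ (⊤ : ℕ∞) (fun y => cross (gradient P y) (U y)) W := by
  have hg : ContDiffOn ℝ (⊤ : ℕ∞) (gradient P) W :=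
    (InnerProductSpace.toDual ℝ (EuclideanSpace ℝ (Fin 3))).symm.contDiff.comp_contDiffOn
      (hP.fderiv_of_isOpen hW (by simp))
  exact (crossCLM.contDiff.comp_contDiffOn hg).clm_apply hU

/-- **`curl Ũ = φ(P) ω + φ'(P) N` on `W`**, `ω = curl U`, `N = ∇P × U`. -/
theorem curl_modulate_of_mem (hW : IsOpen W) (hWN : W ⊆ Nn) (hU : ContDiffOn ℝ (⊤ : ℕ∞) U W)
    (hP : ContDiffOn ℝ (⊤ : ℕ∞) P W) (hφ : ContDiff ℝ (⊤ : ℕ∞) φ) (hx : x ∈ W) :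
    curl (Nn.indicator fun y => φ (P y) • U y) x =
      φ (P x) • curl U x + deriv φ (P x) • cross (gradient P x) (U x) := by
  rw [curl_eq_curlCLM, (modulate_eventuallyEq (U := U) (P := P) (φ := φ) hW hWN hx).fderiv_eq
    (𝕜 := ℝ), ← curl_eq_curlCLM]
  exact curl_smul_comp ((hU.contDiffAt (hW.mem_nhds hx)).differentiableAt (by simp))
    ((hP.contDiffAt (hW.mem_nhds hx)).differentiableAt (by simp))
    (hφ.contDiffAt.differentiableAt (by simp))

/-- The same identity as an eventual equality of functions near a point of `W`. -/
theorem curl_modulate_eventuallyEq (hW : IsOpen W) (hWN : W ⊆ Nn) (hU : ContDiffOn ℝ (⊤ : ℕ∞) U W)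
    (hP : ContDiffOn ℝ (⊤ : ℕ∞) P W) (hφ : ContDiff ℝ (⊤ : ℕ∞) φ) (hx : x ∈ W) :
    curl (Nn.indicator fun y => φ (P y) • U y) =ᶠ[𝓝 x]
      fun y => φ (P y) • curl U y + deriv φ (P y) • cross (gradient P y) (U y) := by
  filter_upwards [hW.mem_nhds hx] with y hy using curl_modulate_of_mem hW hWN hU hP hφ hy

/-- **`curl curl Ũ = φ(P) curl ω + φ'(P) (∇P × ω + curl N) + φ''(P) ∇P × N` on `W`.** -/
theorem curl_curl_modulate_of_mem (hW : IsOpen W) (hWN : W ⊆ Nn) (hU : ContDiffOn ℝ (⊤ : ℕ∞) U W)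
    (hP : ContDiffOn ℝ (⊤ : ℕ∞) P W) (hφ : ContDiff ℝ (⊤ : ℕ∞) φ) (hx : x ∈ W) :
    curl (curl (Nn.indicator fun y => φ (P y) • U y)) x =
      φ (P x) • curl (curl U) x +
        deriv φ (P x) • (cross (gradient P x) (curl U x) +
          curl (fun y => cross (gradient P y) (U y)) x) +
        deriv (deriv φ) (P x) • cross (gradient P x) (cross (gradient P x) (U x)) := by
  rw [curl_eq_curlCLM, (curl_modulate_eventuallyEq hW hWN hU hP hφ hx).fderiv_eq (𝕜 := ℝ),
    ← curl_eq_curlCLM]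
  have hPx : DifferentiableAt ℝ P x := (hP.contDiffAt (hW.mem_nhds hx)).differentiableAt (by simp)
  have hωx : DifferentiableAt ℝ (curl U) x :=
    ((contDiffOn_curl_of_isOpen hW hU).contDiffAt (hW.mem_nhds hx)).differentiableAt (by simp)
  have hNx : DifferentiableAt ℝ (fun y => cross (gradient P y) (U y)) x :=
    ((contDiffOn_cross_gradient hW hU hP).contDiffAt (hW.mem_nhds hx)).differentiableAt (by simp)
  have hφ' : ContDiff ℝ (⊤ : ℕ∞) (deriv φ) := by
    have h := hφ
    rw [show ((⊤ : ℕ∞) : WithTop ℕ∞) = (⊤ : ℕ∞) from rfl, contDiff_infty_iff_deriv] at h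
    exact h.2
  have hφx : DifferentiableAt ℝ φ (P x) := hφ.contDiffAt.differentiableAt (by simp)
  have hφ'x : DifferentiableAt ℝ (deriv φ) (P x) := hφ'.contDiffAt.differentiableAt (by simp)
  have hd1 : DifferentiableAt ℝ (fun y => φ (P y) • curl U y) x :=
    (hasFDerivAt_comp_scalar hPx hφx.hasDerivAt).differentiableAt.smul hωx
  have hd2 : DifferentiableAt ℝ (fun y => deriv φ (P y) • cross (gradient P y) (U y)) x :=
    (hasFDerivAt_comp_scalar hPx hφ'x.hasDerivAt).differentiableAt.smul hNx
  rw [curl_add hd1 hd2, curl_smul_comp hωx hPx hφx, curl_smul_comp hNx hPx hφ'x]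
  simp only [smul_add]
  abel

/-- A field vanishing near `x` has `curl V x = 0` and `curl curl V x = 0`. -/
theorem curl_curl_eq_zero_of_eventuallyEq {V : EuclideanSpace ℝ (Fin 3) → EuclideanSpace ℝ (Fin 3)}
    (h0 : V =ᶠ[𝓝 x] fun _ => 0) : curl V x = 0 ∧ curl (curl V) x = 0 := by
  have hc : curl V =ᶠ[𝓝 x] fun _ => 0 := by
    have h0' : ∀ᶠ y in 𝓝 x, V =ᶠ[𝓝 y] fun _ => (0 : EuclideanSpace ℝ (Fin 3)) := h0.eventually_nhds
    filter_upwards [h0'] with y hy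
    rw [curl_eq_curlCLM, hy.fderiv_eq (𝕜 := ℝ), fderiv_const_apply, map_zero]
  constructor
  · exact hc.eq_of_nhds
  · rw [curl_eq_curlCLM, hc.fderiv_eq (𝕜 := ℝ), fderiv_const_apply, map_zero]

/-- In the zero zones all derivatives of the modulated field vanish: `curl Ũ x = 0` and
`curl curl Ũ x = 0`. -/
theorem curl_modulate_eq_zero (hφ0 : ∀ t, t ≤ ε ∨ 2 * ε ≤ t → φ t = 0)
    (hz : (∀ᶠ y in 𝓝 x, y ∈ Nn ∧ P y < ε) ∨ (∀ᶠ y in 𝓝 x, y ∈ Nn → 2 * ε < P y)) :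
    curl (Nn.indicator fun y => φ (P y) • U y) x = 0 ∧
      curl (curl (Nn.indicator fun y => φ (P y) • U y)) x = 0 :=
  curl_curl_eq_zero_of_eventuallyEq (modulate_eventuallyEq_zero (U := U) hφ0 hz)

/-! ### Pointwise densities -/

/-- **Superhelicity density of the modulated field on `W`** as a quadratic expression in
`φ, φ', φ''` at `P x`: with `ω = curl U x`, `N = ∇P × U`,
`⟪curl Ũ, curl curl Ũ⟫ = φ² ⟪ω, curl ω⟫ + φφ' (⟪ω, ∇P×ω + curl N⟫ + ⟪N, curl ω⟫)
  + φφ'' ⟪ω, ∇P × N⟫ + φ'² ⟪N, ∇P×ω + curl N⟫` (the `φ'φ''` term `⟪N, ∇P × N⟫` vanishes). -/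
theorem inner_curl_curl_curl_modulate (hW : IsOpen W) (hWN : W ⊆ Nn) (hU : ContDiffOn ℝ (⊤ : ℕ∞) U W)
    (hP : ContDiffOn ℝ (⊤ : ℕ∞) P W) (hφ : ContDiff ℝ (⊤ : ℕ∞) φ) (hx : x ∈ W) :
    ⟪curl (Nn.indicator fun y => φ (P y) • U y) x,
        curl (curl (Nn.indicator fun y => φ (P y) • U y)) x⟫ =
      φ (P x) ^ 2 * ⟪curl U x, curl (curl U) x⟫ +
      φ (P x) * deriv φ (P x) *
        (⟪curl U x, cross (gradient P x) (curl U x) + curl (fun y => cross (gradient P y) (U y)) x⟫ +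
          ⟪cross (gradient P x) (U x), curl (curl U) x⟫) +
      φ (P x) * deriv (deriv φ) (P x) * ⟪curl U x, cross (gradient P x) (cross (gradient P x) (U x))⟫ +
      deriv φ (P x) ^ 2 * ⟪cross (gradient P x) (U x),
        cross (gradient P x) (curl U x) + curl (fun y => cross (gradient P y) (U y)) x⟫ := by
  rw [curl_modulate_of_mem hW hWN hU hP hφ hx, curl_curl_modulate_of_mem hW hWN hU hP hφ hx]
  have h0 : ⟪cross (gradient P x) (U x), cross (gradient P x) (cross (gradient P x) (U x))⟫ = 0 := by
    simp [cross, cross_apply, PiLp.inner_apply, Fin.sum_univ_three]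
    ring
  simp only [inner_add_left, inner_add_right, real_inner_smul_left, real_inner_smul_right]
  rw [h0]
  ring

/-- **Polarised density**: for the unmodulated field on the other side,
`⟪curl Ũ, curl curl U⟫ + ⟪curl U, curl curl Ũ⟫ = 2φ ⟪ω, curl ω⟫ + φ'(⟪ω, ∇P×ω + curl N⟫ + ⟪N, curl ω⟫)
 + φ'' ⟪ω, ∇P × N⟫` at `P x`. -/
theorem inner_curl_plateau (hW : IsOpen W) (hWN : W ⊆ Nn) (hU : ContDiffOn ℝ (⊤ : ℕ∞) U W)
    (hP : ContDiffOn ℝ (⊤ : ℕ∞) P W) (hφ : ContDiff ℝ (⊤ : ℕ∞) φ) (hx : x ∈ W) :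
    ⟪curl (Nn.indicator fun y => φ (P y) • U y) x, curl (curl U) x⟫ +
      ⟪curl U x, curl (curl (Nn.indicator fun y => φ (P y) • U y)) x⟫ =
      2 * φ (P x) * ⟪curl U x, curl (curl U) x⟫ +
      deriv φ (P x) *
        (⟪curl U x, cross (gradient P x) (curl U x) + curl (fun y => cross (gradient P y) (U y)) x⟫ +
          ⟪cross (gradient P x) (U x), curl (curl U) x⟫) +
      deriv (deriv φ) (P x) * ⟪curl U x, cross (gradient P x) (cross (gradient P x) (U x))⟫ := by
  rw [curl_modulate_of_mem hW hWN hU hP hφ hx, curl_curl_modulate_of_mem hW hWN hU hP hφ hx]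
  simp only [inner_add_left, inner_add_right, real_inner_smul_left, real_inner_smul_right]
  ring

/-- **Helicity density of the modulated field on `W`**: `⟪Ũ, curl Ũ⟫ = φ(P)² ⟪U, curl U⟫`
(the term `⟪U, ∇P × U⟫` vanishes). -/
theorem inner_modulate_curl_modulate (hW : IsOpen W) (hWN : W ⊆ Nn) (hU : ContDiffOn ℝ (⊤ : ℕ∞) U W)
    (hP : ContDiffOn ℝ (⊤ : ℕ∞) P W) (hφ : ContDiff ℝ (⊤ : ℕ∞) φ) (hx : x ∈ W) :
    ⟪Nn.indicator (fun y => φ (P y) • U y) x, curl (Nn.indicator fun y => φ (P y) • U y) x⟫ =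
      φ (P x) ^ 2 * ⟪U x, curl U x⟫ := by
  rw [curl_modulate_of_mem hW hWN hU hP hφ hx, indicator_of_mem (hWN hx)]
  have h0 : ⟪U x, cross (gradient P x) (U x)⟫ = 0 := by
    simp [cross, cross_apply, PiLp.inner_apply, Fin.sum_univ_three]
    ring
  simp only [inner_add_right, real_inner_smul_left, real_inner_smul_right]
  rw [h0]
  ring

end Curl

end Summit.NavierStokesRegularity.NavierStokesRegularity.Theorems.ChiralEddyExists
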